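import Literature.Analysis.FluidPDE.HouLiAxisModel
import HarnessLib

/-!
# Hou–Wang 2024: the weak-advection Hou–Li axis model — finite-time blow-up from smooth data,
# inviscid (Thm 1.2) and VISCOUS (Thm 1.5), and the exact self-similar ansatz of its steady states

T. Y. Hou, Y. Wang, *Blowup analysis for a quasi-exact 1D model of 3D Euler and Navier–Stokes*,
Nonlinearity **37** (2024) 035001 = arXiv:2306.04146 [HouWang2024] (`p.`/`L` = chunk/line of the held
arXiv rendering `paper:arxiv-2306.04146`).

HONEST FRAMING (cell ns-blowup, profile zone Z5 «Hou interior candidates transplanted to constant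
viscosity»; SELFSIM-NOGO (M10) «the one exact 1-D reduction of axisymmetric NS along the axis (Hou–Li 2008)
is GLOBALLY REGULAR; its blow-ups need the advection weakened, which leaves NS»; D-0081 A4 topic 1).
**1-D MODEL with a WEAKENED ADVECTION parameter `a < 1` — for `a ≠ 1` it is NOT a reduction of Euler or
Navier–Stokes; for `a = 1` it is the Hou–Li axis model `HouLiAxisModel`, which is globally regular for
`ν > 0` (`houLi2008_axisModel_globalRegularity`).** The blow-up solutions are `2π`-periodic in `z` and do
not decay, so their `a = 1` lifts `u^θ = r u₁(z,t)` would have infinite energy anyway. Nothing here is a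
statement about Navier–Stokes.

## What is printed

§1.1 (p0004 L17–L48): the Hou–Li axis model (eq. (1d)) "`u_{1,t} + 2ψ₁u_{1,z} = 2ψ_{1,z}u₁ + νu_{1,zz}`,
`ω_{1,t} + 2ψ₁ω_{1,z} = (u₁²)_z + νω_{1,zz}`, `−ψ_{1,zz} = ω₁`" ("Such a reduction is exact … We assume
that the solutions are periodic in `z` on `[0, 2π]`"), and the **weak advection model** (eq. (1dwp))
"`u_t + 2aψu_z = 2uψ_z + νu_zz`, `ω_t + 2aψω_z = (u²)_z + νω_zz`, `−ψ_zz = ω`, where `a` is a parameter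
that measures the relative strength of advection in the Hou–Li model" (motivated by Hou's interior
scenario: near the maximum of `u₁` the axial velocity `2ψ₁ + rψ_{1,r}` is weaker than `2ψ₁`, p0004 L46).

§1.2 (p0004 L56 – p0005 L15):
* **Theorem 1.2.** "For the weak advection model (1dwp) in the inviscid case `ν = 0`, there exists a
  constant `δ > 0` such that for `a ∈ (1−δ, 1)`, the weak advection model (1dwp) develops a finite time
  singularity for some `C^∞` initial data. Moreover, there exists a self-similar profile
  `(ω_∞, u_∞, ψ_∞)` corresponding to a blowup that is neither expanding nor focusing. More precisely, the
  blowup solution to (1dwp) has the form `ω(x,t) = ω_∞/(1 + c_{u,∞}t)`, `u(x,t) = u_∞/(1 + c_{u,∞}t)`,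
  `ψ(x,t) = ψ_∞/(1 + c_{u,∞}t)`, for some negative constant `c_{u,∞}` with a blowup time given by
  `T = −1/c_{u,∞}`." (Remark 1.3: observed numerically for `a ∈ [0.6, 0.9]`; `c_{u,∞} = O(|a−1|)`.)
* **Theorem 1.4.** "Consider the Hou–Li model (1d) in the inviscid case `ν = 0`. For any `α < 1`, (1d)
  develops a finite time singularity for some `C^α` initial data …" (NOT typed: `C^α` data are not
  classical solutions of the `u`-equation; recorded only.)
* **Theorem 1.5.** "Consider the weak advection model (1dwp) with viscosity. There exists a constant
  `δ₁ > 0` such that for `a ∈ (1−δ₁, 1)`, the weak advection model (1dwp) develops a finite time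
  singularity for some `C^∞` initial data."
§2.1 (p0007 L5–L27): dynamic rescaling `ũ = C_u(τ)u(x, t(τ))` (same factor for `ω, ψ`, NO spatial
rescaling), `C_u = exp∫c_u`, `t(τ) = ∫C_u`, rescaled system (1drf) `ũ_τ + 2aψ̃ũ_x = 2ũψ̃_x + c_uũ`,
`ω̃_τ + 2aψ̃ω̃_x = (ũ²)_x + c_uω̃`, `−ψ̃_xx = ω̃`; "if `(ũ, ω̃, ψ̃, c_u)` converges to a steady state
`(u_∞, ω_∞, ψ_∞, c_{u,∞})` of (1drf), then [the displayed form] is a self-similar solution of (1dwp)";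
blow-up ⇐ "dynamic stability … with scaling parameter `c_u < −ε < 0` uniformly in time"
(p0007 L25; viscous: §5.1 p0014 L37, §5.4 p0016 L56 "`c_u + c̄_u … < (a−1) < 0` … Thus we can obtain a
blowup in finite time in the physical variables": `C_u(τ) → 0`, `T = t(∞) < ∞`, and
`‖u(t)‖_∞ = C_u⁻¹‖ũ‖_∞ → ∞` since `ũ` stays near `ū ≈ sin x`). Proof partly computer-assisted
(rigorous eigenvalue bounds for a few Fourier modes, p0005 L19).

## Contents

* `WeakAdvectionHouLi S a ν U Ω Ψ t z` — (1dwp) at a point (time first, the conventions of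
  `HouLiAxisModel`); `WeakAdvectionHouLi.IsClassicalSolutionOn`; PROVED: at `a = 1` it IS the Hou–Li
  axis model (`weakAdvectionHouLi_one_iff`, `IsClassicalSolutionOn.houLi_iff_one`).
* `WeakAdvectionHouLi.IsSteadyState a c u ω ψ` — classical steady states of (1drf) with constant scaling
  parameter `c`; `selfSimilarSep c P t z = (1 + ct)⁻¹ P z`; PROVED (`IsSteadyState.weakAdvectionHouLi_sep`):
  a `C¹ × C¹ × C²` steady state generates, for `c < 0`, an EXACT separated-variables solution of the
  inviscid (1dwp) on `[0, −1/c)` — the printed §2.1 sentence as a kernel theorem (no existence claimed).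
* `SupBlowsUpAt U T` — `limsup_{t↑T} ‖U(t)‖_∞ = ∞` in the tree's "frequently" form.
* NAMED FACTS (typed by printed consequences, weaker than print; periodic smooth data prescribed as
  `(U₀, Ψ₀)` with `Ω₀ = −Ψ₀''`, the datum class of `houLi2008_axisModel_globalRegularity` with period `2π`):
  `HouWang2024_weakAdvection_inviscidBlowup` (Thm 1.2) and `HouWang2024_weakAdvection_viscousBlowup`
  (Thm 1.5, stated for every fixed `ν > 0`, the reading of "with viscosity"; all `ν > 0` are equivalent
  under `(u, ω, ψ, t) ↦ (λu, λω, λψ, t/λ)`, `ν ↦ λν`). NOT asserted: the exact self-similar form of the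
  blow-up solution (regularity of the limit profile is not printed), profile uniqueness/convergence, Thm 1.4.
* COROLLARY by name (`…viscousBlowup.not_global_at`): under Thm 1.5 the weak-advection family is NOT
  globally regular for `a` slightly below `1`, in contrast with the `a = 1` fact
  `houLi2008_axisModel_globalRegularity` (period `1` there, `2π` here — recorded, not reconciled).
-/

noncomputable section

open Set Function Filter Topology
open scoped ContDiff

namespace Literature.Analysis.FluidPDE

/-! ### The weak advection model at a point and its classical solutions -/

/-- **The weak-advection Hou–Li model (1dwp) at the space–time point `(t, z)`** for the unknowns
`U = u`, `Ω = ω`, `Ψ = ψ : ℝ → ℝ → ℝ` (time first), advection strength `a`, viscosity `ν`: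
`Uₜ + 2aΨU_z = 2UΨ_z + νU_zz`, `Ωₜ + 2aΨΩ_z = (U²)_z + νΩ_zz`, `−Ψ_zz = Ω`; time derivative one-sided
within the time set `S`. [cite: HouWang2024, §1.1 eq. (1dwp) (arXiv:2306.04146 p0004 L48–L56)] -/
structure WeakAdvectionHouLi (S : Set ℝ) (a ν : ℝ) (U Ω Ψ : ℝ → ℝ → ℝ) (t z : ℝ) : Prop where
  /-- `uₜ + 2aψu_z = 2uψ_z + νu_zz`. -/
  u_eq : timeDerivWithin S U t z + 2 * a * Ψ t z * deriv (U t) z =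
    2 * U t z * deriv (Ψ t) z + ν * deriv (deriv (U t)) z
  /-- `ωₜ + 2aψω_z = (u²)_z + νω_zz`. -/
  ω_eq : timeDerivWithin S Ω t z + 2 * a * Ψ t z * deriv (Ω t) z =
    deriv (fun z' => U t z' ^ 2) z + ν * deriv (deriv (Ω t)) z
  /-- `−ψ_zz = ω`. -/
  ψ_eq : -deriv (deriv (Ψ t)) z = Ω t z

/-- **At `a = 1` the weak advection model IS the Hou–Li axis model** ("`a` … measures the relative
strength of advection in the Hou–Li model"; (1d) = (1dwp) with `a = 1`).
[cite: HouWang2024, §1.1 eqs. (1d), (1dwp) (arXiv:2306.04146 p0004 L17, L48)] -/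
theorem weakAdvectionHouLi_one_iff {S : Set ℝ} {ν : ℝ} {U Ω Ψ : ℝ → ℝ → ℝ} {t z : ℝ} :
    WeakAdvectionHouLi S 1 ν U Ω Ψ t z ↔ HouLiAxisModel S ν U Ω Ψ t z := by
  constructor
  · rintro ⟨hu, hω, hψ⟩
    refine ⟨?_, ?_, hψ⟩
    · rw [mul_one] at hu; rw [hu]; ring
    · rw [mul_one] at hω; rw [hω]; ring
  · rintro ⟨hu, hω, hψ⟩
    refine ⟨?_, ?_, hψ⟩
    · rw [mul_one, hu]; ring
    · rw [mul_one, hω]; ring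

namespace WeakAdvectionHouLi

/-- **Classical solutions of (1dwp) on the time set `S`**: `U, Ω, Ψ` jointly `C^∞` on `S × ℝ` and the
three equations at every `t ∈ S`, `z ∈ ℝ` (the conventions of `HouLiAxisModel.IsClassicalSolutionOn`).
[cite: HouWang2024, §1.1 eq. (1dwp) (arXiv:2306.04146 p0004 L48); §1.2 (C^∞ data)] -/
structure IsClassicalSolutionOn (S : Set ℝ) (a ν : ℝ) (U Ω Ψ : ℝ → ℝ → ℝ) : Prop where
  /-- `U` is jointly smooth on `S × ℝ`. -/
  smooth_U : IsSmoothSpaceTimeOn S U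
  /-- `Ω` is jointly smooth on `S × ℝ`. -/
  smooth_Ω : IsSmoothSpaceTimeOn S Ω
  /-- `Ψ` is jointly smooth on `S × ℝ`. -/
  smooth_Ψ : IsSmoothSpaceTimeOn S Ψ
  /-- The equations (1dwp) hold on `S × ℝ`. -/
  equations : ∀ t ∈ S, ∀ z : ℝ, WeakAdvectionHouLi S a ν U Ω Ψ t z

/-- At `a = 1`, classical solutions of (1dwp) are exactly the classical solutions of the Hou–Li axis
model. [cite: HouWang2024, §1.1 eqs. (1d), (1dwp) (arXiv:2306.04146 p0004 L17, L48)] -/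
theorem IsClassicalSolutionOn.houLi_iff_one {S : Set ℝ} {ν : ℝ} {U Ω Ψ : ℝ → ℝ → ℝ} :
    IsClassicalSolutionOn S 1 ν U Ω Ψ ↔ HouLiAxisModel.IsClassicalSolutionOn S ν U Ω Ψ := by
  constructor
  · rintro ⟨h1, h2, h3, h4⟩
    exact ⟨h1, h2, h3, fun t ht z => weakAdvectionHouLi_one_iff.1 (h4 t ht z)⟩
  · rintro ⟨h1, h2, h3, h4⟩
    exact ⟨h1, h2, h3, fun t ht z => weakAdvectionHouLi_one_iff.2 (h4 t ht z)⟩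

/-! ### Steady states of the rescaled system and the exact self-similar ansatz (§2.1) -/

/-- **Classical steady states of the dynamic-rescaling system (1drf) with constant scaling parameter
`c`** (inviscid): `2aψu' = 2uψ' + cu`, `2aψω' = (u²)' + cω`, `−ψ'' = ω`, with `u, ω ∈ C¹`, `ψ ∈ C²`.
[cite: HouWang2024, §2.1 eq. (1drf) and the sentence after Remark 2.1 (arXiv:2306.04146 p0007 L11–L27)] -/
structure IsSteadyState (a c : ℝ) (u om ps : ℝ → ℝ) : Prop where
  /-- `u_∞` is differentiable -/
  diff_u : Differentiable ℝ u
  /-- `ω_∞` is differentiable -/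
  diff_ω : Differentiable ℝ om
  /-- `ψ_∞` is `C²` -/
  diff_ψ : ContDiff ℝ 2 ps
  /-- `2aψ_∞u_∞' = 2u_∞ψ_∞' + cu_∞` -/
  u_eq : ∀ x, 2 * a * ps x * deriv u x = 2 * u x * deriv ps x + c * u x
  /-- `2aψ_∞ω_∞' = (u_∞²)' + cω_∞` -/
  ω_eq : ∀ x, 2 * a * ps x * deriv om x = deriv (fun y => u y ^ 2) x + c * om x
  /-- `−ψ_∞'' = ω_∞` -/
  ψ_eq : ∀ x, -deriv (deriv ps) x = om x

/-- The separated-variables (non-focusing, non-expanding) self-similar function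
`(t, z) ↦ P(z)/(1 + ct)` of the printed blow-up form. [cite: HouWang2024, §1.2 Thm 1.2 display; §2.1 (arXiv:2306.04146 p0004 L62, p0007 L27)] -/
def selfSimilarSep (c : ℝ) (P : ℝ → ℝ) (t z : ℝ) : ℝ := (1 + c * t)⁻¹ * P z

/-- The time factor `1 + ct` is positive on `[0, −1/c)` for `c < 0`.
[cite: HouWang2024, §1.2 Thm 1.2 (T = −1/c_{u,∞}) (arXiv:2306.04146 p0004 L62)] -/
theorem one_add_mul_pos {c t : ℝ} (hc : c < 0) (ht : t ∈ Ico 0 (-1 / c)) : 0 < 1 + c * t := by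
  have h2 : t < -1 / c := ht.2
  have hc0 : c ≠ 0 := hc.ne
  have : c * t > c * (-1 / c) := mul_lt_mul_of_neg_left h2 hc
  have hcc : c * (-1 / c) = -1 := by field_simp
  linarith

/-- Time derivative of the separated function within `[0, −1/c)`:
`∂ₜ[(1+ct)⁻¹P(z)] = −c(1+ct)⁻²P(z)`. [cite: HouWang2024, §2.1 (arXiv:2306.04146 p0007 L5–L27)] -/
theorem timeDerivWithin_selfSimilarSep {c : ℝ} (hc : c < 0) (P : ℝ → ℝ) {t : ℝ}
    (ht : t ∈ Ico 0 (-1 / c)) (z : ℝ) :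
    timeDerivWithin (Ico 0 (-1 / c)) (selfSimilarSep c P) t z =
      -c * (1 + c * t)⁻¹ ^ 2 * P z := by
  have hpos := one_add_mul_pos hc ht
  have h1 : HasDerivAt (fun s : ℝ => 1 + c * s) c t := by
    simpa using ((hasDerivAt_id t).const_mul c).const_add 1
  have h2 : HasDerivAt (fun s : ℝ => selfSimilarSep c P s z) (-((1 + c * t) ^ 2)⁻¹ * c * P z) t := by
    have h := ((hasDerivAt_inv hpos.ne').comp t h1).mul_const (P z)
    exact h.congr_of_eventuallyEq (Filter.Eventually.of_forall fun s => rfl)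
  rw [timeDerivWithin_apply, (h2.hasDerivWithinAt).derivWithin (uniqueDiffOn_Ico 0 (-1 / c) t ht)]
  rw [inv_pow]
  ring

/-- `z`-derivative of the separated function: `∂_z[(1+ct)⁻¹P] = (1+ct)⁻¹P'`.
[cite: HouWang2024, §2.1 (arXiv:2306.04146 p0007 L5–L27)] -/
theorem deriv_selfSimilarSep (c : ℝ) (P : ℝ → ℝ) (t z : ℝ) :
    deriv (selfSimilarSep c P t) z = (1 + c * t)⁻¹ * deriv P z := by
  show deriv (fun z => (1 + c * t)⁻¹ * P z) z = _
  exact deriv_const_mul_field _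

/-- Second `z`-derivative of the separated function. [cite: HouWang2024, §2.1 (arXiv:2306.04146 p0007 L5–L27)] -/
theorem deriv_deriv_selfSimilarSep (c : ℝ) (P : ℝ → ℝ) (t z : ℝ) :
    deriv (deriv (selfSimilarSep c P t)) z = (1 + c * t)⁻¹ * deriv (deriv P) z := by
  have : deriv (selfSimilarSep c P t) = fun z => (1 + c * t)⁻¹ * deriv P z :=
    funext (deriv_selfSimilarSep c P t)
  rw [this]
  exact deriv_const_mul_field _

/-- **The printed §2.1 sentence as a kernel theorem**: a classical steady state `(u_∞, ω_∞, ψ_∞, c)` of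
(1drf) with `c < 0` generates the EXACT self-similar solution `(u, ω, ψ)(z,t) = (1 + ct)⁻¹(u_∞, ω_∞, ψ_∞)(z)`
of the inviscid weak advection model on `[0, T)`, `T = −1/c` ("neither expanding nor focusing": no spatial
rescaling). No existence of a steady state is claimed here. [cite: HouWang2024, §2.1 (arXiv:2306.04146 p0007 L25–L27); §1.2 Thm 1.2 display (p0004 L62)] -/
theorem IsSteadyState.weakAdvectionHouLi_sep {a c : ℝ} {u om ps : ℝ → ℝ}
    (h : IsSteadyState a c u om ps) (hc : c < 0) {t : ℝ} (ht : t ∈ Ico 0 (-1 / c)) (z : ℝ) :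
    WeakAdvectionHouLi (Ico 0 (-1 / c)) a 0 (selfSimilarSep c u) (selfSimilarSep c om)
      (selfSimilarSep c ps) t z := by
  have hpos := one_add_mul_pos hc ht
  set s : ℝ := (1 + c * t)⁻¹ with hs
  have hsq : deriv (fun z' => selfSimilarSep c u t z' ^ 2) z = s ^ 2 * deriv (fun y => u y ^ 2) z := by
    have h1 : (fun z' => selfSimilarSep c u t z' ^ 2) = fun z' => s ^ 2 * u z' ^ 2 := by
      funext z'; simp only [selfSimilarSep, hs]; ring
    rw [h1, deriv_const_mul_field]
  refine ⟨?_, ?_, ?_⟩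
  · rw [timeDerivWithin_selfSimilarSep hc u ht, deriv_selfSimilarSep, deriv_selfSimilarSep, zero_mul,
      add_zero]
    simp only [selfSimilarSep, ← hs]
    have := h.u_eq z
    nlinarith [this, sq_nonneg s]
  · rw [timeDerivWithin_selfSimilarSep hc om ht, deriv_selfSimilarSep, hsq, zero_mul, add_zero]
    simp only [selfSimilarSep, ← hs]
    have := h.ω_eq z
    nlinarith [this, sq_nonneg s]
  · rw [deriv_deriv_selfSimilarSep]
    simp only [selfSimilarSep, ← hs]
    have := h.ψ_eq z
    calc -(s * deriv (deriv ps) z) = s * (-deriv (deriv ps) z) := by ring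
      _ = s * om z := by rw [this]

end WeakAdvectionHouLi

/-! ### Blow-up of the sup norm -/

/-- **Sup-norm blow-up at time `T`** of a scalar space–time function: `limsup_{t ↑ T} ‖U(t)‖_{L^∞} = ∞`,
stated as: for every `M`, frequently as `t ↑ T` some `z` has `|U t z| > M` (the form of the tree's
`VorticityBlowsUpAt`). [cite: HouWang2024, §1.2 Thms 1.2/1.5 ("develops a finite time singularity") with §2.1 (c_u < −ε ⇒ C_u → 0) (arXiv:2306.04146 p0004 L60, p0005 L15, p0007 L25)] -/
def SupBlowsUpAt (U : ℝ → ℝ → ℝ) (T : ℝ) : Prop :=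
  ∀ M : ℝ, ∃ᶠ t in 𝓝[<] T, ∃ z : ℝ, M < |U t z|

/-! ### The named facts -/

/-- **Hou–Wang 2024, Theorem 1.2 (inviscid weak advection model: finite-time blow-up from smooth data
for `a` slightly below `1`)**, typed by its printed consequence: there is `δ > 0` such that for every
`a ∈ (1−δ, 1)` there exist smooth `2π`-periodic data `(U₀, Ψ₀)` (with `Ω₀ = −Ψ₀''`), a finite time
`T > 0` and a classical solution of (1dwp) with `ν = 0` on `[0, T) × ℝ`, `2π`-periodic in `z`, issuing
from these data, whose sup norm `‖u(t)‖_∞` is unbounded as `t ↑ T` (printed route: `C_u(τ) → 0`,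
`T = t(∞)`, `u = C_u⁻¹ũ` with `ũ` near `ū ≈ sin x`). NOT asserted: the exactly self-similar form of the
blow-up solution / existence and regularity of the limit profile `(u_∞, ω_∞, ψ_∞)` (see
`IsSteadyState.weakAdvectionHouLi_sep` for the ansatz as a theorem), Remark 1.3's numerics.
[cite: HouWang2024, §1.2 Theorem 1.2 (arXiv:2306.04146 p0004 L58–L63); §2.1 (p0007 L5–L27)] -/
def HouWang2024_weakAdvection_inviscidBlowup : Prop :=
  ∃ δ : ℝ, 0 < δ ∧ ∀ a : ℝ, 1 - δ < a → a < 1 →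
    ∃ U₀ Ψ₀ : ℝ → ℝ, ContDiff ℝ ∞ U₀ ∧ ContDiff ℝ ∞ Ψ₀ ∧
      Periodic U₀ (2 * Real.pi) ∧ Periodic Ψ₀ (2 * Real.pi) ∧
      ∃ T : ℝ, 0 < T ∧ ∃ U Ω Ψ : ℝ → ℝ → ℝ,
        WeakAdvectionHouLi.IsClassicalSolutionOn (Ico 0 T) a 0 U Ω Ψ ∧
        (∀ t ∈ Ico 0 T, Periodic (U t) (2 * Real.pi) ∧ Periodic (Ω t) (2 * Real.pi) ∧
          Periodic (Ψ t) (2 * Real.pi)) ∧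
        U 0 = U₀ ∧ Ψ 0 = Ψ₀ ∧ SupBlowsUpAt U T

/-- **Hou–Wang 2024, Theorem 1.5 (VISCOUS weak advection model: finite-time blow-up from smooth data
for `a` slightly below `1`)**, typed by its printed consequence, for every fixed viscosity `ν > 0`
("the weak advection model (1dwp) with viscosity"): there is `δ₁ > 0` such that for every
`a ∈ (1−δ₁, 1)` there exist smooth `2π`-periodic data, a finite `T > 0` and a classical solution of
(1dwp) with this `ν` on `[0, T) × ℝ`, `2π`-periodic, issuing from the data, with `‖u(t)‖_∞` unbounded as
`t ↑ T` (printed route §5.4: `c_u + c̄_u < a − 1 < 0`, "Thus we can obtain a blowup in finite time in the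
physical variables"). For `a = 1` the opposite holds (`houLi2008_axisModel_globalRegularity`).
[cite: HouWang2024, §1.2 Theorem 1.5 (arXiv:2306.04146 p0005 L13–L15); §5.1, §5.4 (p0014 L37, p0016 L35–L56)] -/
def HouWang2024_weakAdvection_viscousBlowup : Prop :=
  ∀ ν : ℝ, 0 < ν → ∃ δ₁ : ℝ, 0 < δ₁ ∧ ∀ a : ℝ, 1 - δ₁ < a → a < 1 →
    ∃ U₀ Ψ₀ : ℝ → ℝ, ContDiff ℝ ∞ U₀ ∧ ContDiff ℝ ∞ Ψ₀ ∧
      Periodic U₀ (2 * Real.pi) ∧ Periodic Ψ₀ (2 * Real.pi) ∧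
      ∃ T : ℝ, 0 < T ∧ ∃ U Ω Ψ : ℝ → ℝ → ℝ,
        WeakAdvectionHouLi.IsClassicalSolutionOn (Ico 0 T) a ν U Ω Ψ ∧
        (∀ t ∈ Ico 0 T, Periodic (U t) (2 * Real.pi) ∧ Periodic (Ω t) (2 * Real.pi) ∧
          Periodic (Ψ t) (2 * Real.pi)) ∧
        U 0 = U₀ ∧ Ψ 0 = Ψ₀ ∧ SupBlowsUpAt U T

/-! ### API -/

/-- A function that blows up in sup norm at `T` is not bounded on `[0, T) × ℝ`... precisely: no single
bound `M` dominates `|U t z|` for all `t < T` near `T` and all `z`. [cite: HouWang2024, §1.2 Thms 1.2/1.5 (arXiv:2306.04146 p0004 L60, p0005 L15)] -/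
theorem SupBlowsUpAt.not_bounded {U : ℝ → ℝ → ℝ} {T : ℝ} (h : SupBlowsUpAt U T) (M : ℝ) :
    ¬ ∀ᶠ t in 𝓝[<] T, ∀ z, |U t z| ≤ M := by
  intro hM
  have := (h M).and_eventually hM
  obtain ⟨t, ⟨z, hz⟩, hle⟩ := this.exists
  exact (lt_irrefl M) (hz.trans_le (hle z))

/-- **Under Theorem 1.5, the weak-advection family is not globally regular just below `a = 1`**: for
every `ν > 0` there are `a < 1` arbitrarily close to `1`, smooth periodic data and a classical solution on
a finite interval `[0, T)` whose sup norm blows up at `T` — the printed contrast with the `a = 1` global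
regularity (`houLi2008_axisModel_globalRegularity`, SELFSIM-NOGO (M10)).
[cite: HouWang2024, §1.2 Theorem 1.5 (arXiv:2306.04146 p0005 L13–L15)] -/
theorem HouWang2024_weakAdvection_viscousBlowup.exists_blowup_near_one
    (h : HouWang2024_weakAdvection_viscousBlowup) {ν : ℝ} (hν : 0 < ν) {ε : ℝ} (hε : 0 < ε) :
    ∃ a : ℝ, 1 - ε < a ∧ a < 1 ∧ ∃ T : ℝ, 0 < T ∧ ∃ U Ω Ψ : ℝ → ℝ → ℝ,
      WeakAdvectionHouLi.IsClassicalSolutionOn (Ico 0 T) a ν U Ω Ψ ∧ SupBlowsUpAt U T := by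
  obtain ⟨δ₁, hδ₁, H⟩ := h ν hν
  set a : ℝ := 1 - min δ₁ ε / 2 with ha
  have hmin : 0 < min δ₁ ε := lt_min hδ₁ hε
  have ha1 : 1 - δ₁ < a := by
    have : min δ₁ ε / 2 < δ₁ := lt_of_lt_of_le (half_lt_self hmin) (min_le_left _ _)
    rw [ha]; linarith
  have ha2 : a < 1 := by rw [ha]; linarith
  have ha3 : 1 - ε < a := by
    have : min δ₁ ε / 2 < ε := lt_of_lt_of_le (half_lt_self hmin) (min_le_right _ _)
    rw [ha]; linarith
  obtain ⟨U₀, Ψ₀, -, -, -, -, T, hT, U, Ω, Ψ, hsol, -, -, -, hblow⟩ := H a ha1 ha2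
  exact ⟨a, ha3, ha2, T, hT, U, Ω, Ψ, hsol, hblow⟩

/-! ### The printed explicit steady state at `a = 1` (Remark 1.1) -/

/-- **The explicit steady state `(ω, u, ψ) = (sin x, sin x, sin x)` of the inviscid Hou–Li model**
("We obtain an explicit steady-state to the inviscid Hou–Li model (1d) `(ω,u,ψ) = (sin x, sin x, sin x)`,
similar to the steady state `(ω,u) = (−sin x, sin x)` of the DG model on `S¹`", Remark 1.1) is a classical
steady state of the rescaled system (1drf) at `a = 1` with scaling parameter `c = 0` — non-vacuity of
`WeakAdvectionHouLi.IsSteadyState` and the base point of the paper's perturbative construction for `a`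
close to `1`. [cite: HouWang2024, §1.1 Remark 1.1 (arXiv:2306.04146 p0004 L52)] -/
theorem WeakAdvectionHouLi.isSteadyState_sin :
    WeakAdvectionHouLi.IsSteadyState 1 0 Real.sin Real.sin Real.sin := by
  have hd2 : deriv (deriv Real.sin) = fun x => -Real.sin x := by
    rw [Real.deriv_sin]; funext x; exact (Real.hasDerivAt_cos x).deriv
  have hsq : ∀ x, deriv (fun y => Real.sin y ^ 2) x = 2 * Real.sin x * Real.cos x := fun x => by
    have h2 : HasDerivAt (fun y => Real.sin y ^ 2) ((2 : ℕ) * Real.sin x ^ (2 - 1) * Real.cos x) x :=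
      (Real.hasDerivAt_sin x).pow 2
    rw [h2.deriv]; norm_num
  refine ⟨Real.differentiable_sin, Real.differentiable_sin, Real.contDiff_sin.of_le (by norm_cast),
    fun x => ?_, fun x => ?_, fun x => ?_⟩
  · rw [Real.deriv_sin]; ring
  · rw [hsq, Real.deriv_sin]; ring
  · rw [hd2]; simp

/-- Hence the stationary function `(t, z) ↦ sin z` (all three unknowns) is a classical solution of the
inviscid Hou–Li axis model (`a = 1`, `ν = 0`) on every time set — the printed steady state read through
`weakAdvectionHouLi_one_iff`; a `2π`-periodic, non-decaying exact solution (infinite energy when lifted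
by `u^θ = r u₁`). [cite: HouWang2024, §1.1 Remark 1.1 (arXiv:2306.04146 p0004 L52)] -/
theorem HouLiAxisModel.sin_steady (S : Set ℝ) (t z : ℝ) :
    HouLiAxisModel S 0 (fun _ => Real.sin) (fun _ => Real.sin) (fun _ => Real.sin) t z := by
  have h := WeakAdvectionHouLi.isSteadyState_sin
  have ht : timeDerivWithin S (fun _ : ℝ => Real.sin) t z = 0 := by
    rw [timeDerivWithin_apply]
    exact congrFun (derivWithin_const (𝕜 := ℝ) (c := Real.sin z) (s := S)) t
  refine weakAdvectionHouLi_one_iff.1 ⟨?_, ?_, ?_⟩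
  · rw [ht, zero_add, zero_mul, add_zero]
    have := h.u_eq z; linarith
  · rw [ht, zero_add, zero_mul, add_zero]
    have := h.ω_eq z; linarith
  · exact h.ψ_eq z

end Literature.Analysis.FluidPDE

end
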